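import Summits.Ventures.CertifiedManyBodySolver.Downfold.IntervalCalculus
import HarnessLib

/-!
# The parameter BOX of a downfolded model: graded entries with declared inflation, boxes with
# undetermined coordinates, hull of two sources, words holding on a box

Venture CertifiedManyBodySolver, cell `pub/hubbard-downfold` (HUMAN RULINGS D-0096/D-0098: stage S1 =
DOWNFOLDING FRONT END = ROUTER), seat hubbard-downfold-mod-1; namespace
`Summit.Ventures.CertifiedManyBodySolver.Downfold`. Everything here is PROVED. WHAT THIS IS NOT: a
certified statement about any material — a box is S1's SYSTEMATIC output, a modelling claim with
provenance per coordinate, never a number; no router, no material ↦ box map, no physics.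

* `Grade` — the three confidence classes of the oracle's phase-map schema (memo HORIZON-BREAK §14),
  `certified > screening > extrapolated`, with the weakest-link combination `Grade.weakest`
  (`rank_weakest = min`, `weakest_eq_certified_iff`: certified is never created by combination).
* `Entry` = (base interval with rational end points, declared inflation radius `ℚ≥0` = the named
  systematic error terms of this coordinate summed, grade); `Entry.encl = base.inflate infl` is the
  enclosure the entry CLAIMS; `Entry.hull` (two sources, disjunctive trust: hull of bases, larger
  radius, weaker grade; `mem_hull_of_or`, `hull_grade_eq_certified_iff`); `Entry.inflateBy r g`
  (a further declared error of grade `g`: radii add, grades combine; `mem_inflateBy_of_abs_sub_le`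
  = "three-band → one-band reduction error as explicit box inflation", entry level).
* `Box ι := ι → Option Entry` over a coordinate index type (`none` = UNDETERMINED: no enclosure is
  claimed for that coordinate); `Box.Mem B p` (every present entry encloses its coordinate of `p`),
  `Box.Refines` (semantic containment), `Box.hull` (`mem_hull_left/right`; undetermined in either
  source ⇒ undetermined), `refines_update_none` (dropping a coordinate only weakens).
* `HoldsOn W B` — the word `W` holds at every parameter vector of `B`; its one inference rule
  `HoldsOn.of_refines` (a word certified on a box holds on every box refining it — in particular
  on a downfolded box sitting inside a certified cell), `HoldsOn.mono`, `holdsOn_and_iff`.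

Design: a box asserts NOTHING by itself — every statement the oracle attaches to a material has
the conditional form `B.Mem p⋆ → W p⋆`; the grade records how the hypothesis was obtained and
combines by `min` under every operation. Free-text provenance (kit job ids, bibliographic keys,
referee verdicts) and units (`eV`) have no mathematical content and live in the cell's box schema
(`pub/hubbard-downfold/hubbard-downfold-mod-1/BOX-GRAMMAR.md`), not here. Interval rules:
`Downfold.IntervalCalculus`; Hubbard transport through shape + scale: `Downfold.HubbardScaleTransport`,
`Downfold.OneBandBox`.
-/

namespace Summit.Ventures.CertifiedManyBodySolver.Downfold

open NonemptyInterval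

/-- **Confidence grade** of an enclosure claim, the three classes of the oracle's phase-map schema:
`certified` (every inequality used is a kernel theorem or a certified row), `screening`
(systematic: DFT / Wannier / cRPA / literature values), `extrapolated` (outside the validated
range). [folklore] -/
inductive Grade
  | extrapolated
  | screening
  | certified
  deriving DecidableEq, Repr

namespace Grade

/-- Numerical rank of a grade (`extrapolated < screening < certified`). [folklore] -/
def rank : Grade → ℕ
  | extrapolated => 0
  | screening => 1
  | certified => 2

/-- `rank` is injective (the three grades are distinguished by their rank). [folklore] -/
theorem rank_injective : Function.Injective rank := by
  intro g h hgh
  cases g <;> cases h <;> simp_all [rank]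

/-- **Weakest-link combination**: the grade of anything computed from two graded inputs is the
lower of the two grades. [folklore] -/
def weakest (g h : Grade) : Grade := if g.rank ≤ h.rank then g else h

/-- The rank of the weakest-link combination is the minimum of the ranks. [folklore] -/
theorem rank_weakest (g h : Grade) : (g.weakest h).rank = min g.rank h.rank := by
  unfold weakest
  split_ifs with hle
  · exact (min_eq_left hle).symm
  · exact (min_eq_right (not_le.1 hle).le).symm

/-- Weakest-link combination is commutative. [folklore] -/
theorem weakest_comm (g h : Grade) : g.weakest h = h.weakest g :=
  rank_injective (by rw [rank_weakest, rank_weakest, min_comm])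

/-- Weakest-link combination is idempotent. [folklore] -/
@[simp] theorem weakest_self (g : Grade) : g.weakest g = g := by
  simp [weakest]

/-- **`certified` is not created by combination**: a combination is certified iff both inputs are.
[folklore] -/
theorem weakest_eq_certified_iff {g h : Grade} :
    g.weakest h = certified ↔ g = certified ∧ h = certified := by
  cases g <;> cases h <;> decide

end Grade

/-- **A box coordinate entry**: the base interval as produced by its source, the declared
inflation radius (sum of the named systematic error terms attached to this coordinate) and the
confidence grade of the resulting enclosure claim. [folklore] -/
structure Entry where
  /-- The interval reported by the source (rational end points). -/
  base : NonemptyInterval ℚ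
  /-- Declared inflation radius (nonnegative): the named systematic errors, summed. -/
  infl : ℚ≥0
  /-- Confidence grade of the claim "the true value lies in `base.inflate infl`". -/
  grade : Grade

namespace Entry

/-- The enclosure an entry CLAIMS: its base interval inflated by the declared radius. [folklore] -/
def encl (e : Entry) : NonemptyInterval ℚ := e.base.inflate e.infl

/-- Real membership in an entry's claimed enclosure. [folklore] -/
def Mem (e : Entry) (x : ℝ) : Prop := x ∈ e.encl.ratCast ℝ

/-- **Hull of two entries** (two sources for the same coordinate, disjunctive trust): hull of the
bases, the larger of the two inflation radii, the weaker grade. [folklore] -/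
def hull (e f : Entry) : Entry :=
  ⟨e.base ⊔ f.base, max e.infl f.infl, e.grade.weakest f.grade⟩

/-- The claimed enclosure of a hull contains the claimed enclosure of its left argument. [folklore] -/
theorem encl_le_hull_left (e f : Entry) : e.encl ≤ (e.hull f).encl :=
  (inflate_mono_left le_sup_left e.infl).trans (inflate_mono_right _ (le_max_left _ _))

/-- The claimed enclosure of a hull contains the claimed enclosure of its right argument. [folklore] -/
theorem encl_le_hull_right (e f : Entry) : f.encl ≤ (e.hull f).encl :=
  (inflate_mono_left le_sup_right f.infl).trans (inflate_mono_right _ (le_max_right _ _))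

/-- Hull rule for entries: enclosed by one source ⇒ enclosed by the hull. [folklore] -/
theorem mem_hull_of_or {e f : Entry} {x : ℝ} (h : e.Mem x ∨ f.Mem x) : (e.hull f).Mem x := by
  rcases h with h | h
  · exact mem_ratCast_of_le (encl_le_hull_left e f) h
  · exact mem_ratCast_of_le (encl_le_hull_right e f) h

/-- The grade of a hull is certified iff both sources were. [folklore] -/
theorem hull_grade_eq_certified_iff {e f : Entry} :
    (e.hull f).grade = .certified ↔ e.grade = .certified ∧ f.grade = .certified :=
  Grade.weakest_eq_certified_iff

/-- **Inflate an entry by a further declared error** `r` whose own grade is `g` (e.g. the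
three-band → one-band reduction error, screening-grade): radii add, grades combine. [folklore] -/
def inflateBy (e : Entry) (r : ℚ≥0) (g : Grade) : Entry :=
  ⟨e.base, e.infl + r, e.grade.weakest g⟩

/-- The claimed enclosure after `inflateBy r` is the old one inflated by `r`. [folklore] -/
theorem encl_inflateBy (e : Entry) (r : ℚ≥0) (g : Grade) :
    (e.inflateBy r g).encl = e.encl.inflate r := by
  simp only [encl, inflateBy, inflate_inflate]

/-- **Reduction error as explicit inflation, entry level**: if the source encloses `y` and the
reduction moves the value by at most `r`, the inflated entry encloses the reduced value `x`.
[folklore] -/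
theorem mem_inflateBy_of_abs_sub_le {e : Entry} {r : ℚ≥0} (g : Grade) {x y : ℝ} (hy : e.Mem y)
    (hxy : |x - y| ≤ (r : ℚ)) : (e.inflateBy r g).Mem x := by
  unfold Mem
  rw [encl_inflateBy]
  exact mem_inflate_of_abs_sub_le hy hxy

end Entry

/-- **A parameter box** over a coordinate index type `ι` (e.g. the couplings `t, t', t'', U, J, n`
of a one-band model): per coordinate either an entry or `none` = UNDETERMINED (no enclosure is
claimed for that coordinate). [folklore] -/
def Box (ι : Type*) := ι → Option Entry

namespace Box

variable {ι : Type*}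

/-- **Membership of a parameter vector in a box**: every coordinate for which an entry is present
lies in that entry's claimed enclosure (undetermined coordinates constrain nothing). [folklore] -/
def Mem (B : Box ι) (p : ι → ℝ) : Prop := ∀ i e, B i = some e → e.Mem (p i)

/-- `B.Refines C`: every parameter vector in `B` lies in `C` (semantic containment). [folklore] -/
def Refines (B C : Box ι) : Prop := ∀ p, B.Mem p → C.Mem p

/-- Refinement is reflexive. [folklore] -/
theorem Refines.rfl {B : Box ι} : B.Refines B := fun _ h => h

/-- Refinement is transitive. [folklore] -/
theorem Refines.trans {B C D : Box ι} (h₁ : B.Refines C) (h₂ : C.Refines D) : B.Refines D :=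
  fun p hp => h₂ p (h₁ p hp)

/-- **Hull of two boxes** (two sources, disjunctive trust), coordinatewise; a coordinate
undetermined in either source is undetermined in the hull. [folklore] -/
def hull (B C : Box ι) : Box ι := fun i =>
  match B i, C i with
  | some e, some f => some (e.hull f)
  | _, _ => none

/-- Hull rule for boxes, left source. [folklore] -/
theorem mem_hull_left {B C : Box ι} {p : ι → ℝ} (h : B.Mem p) : (B.hull C).Mem p := by
  intro i g hg
  unfold hull at hg
  cases hB : B i with
  | none => simp [hB] at hg
  | some e =>
    cases hC : C i with
    | none => simp [hB, hC] at hg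
    | some f =>
      simp only [hB, hC, Option.some.injEq] at hg
      subst hg
      exact Entry.mem_hull_of_or (Or.inl (h i e hB))

/-- Hull rule for boxes, right source. [folklore] -/
theorem mem_hull_right {B C : Box ι} {p : ι → ℝ} (h : C.Mem p) : (B.hull C).Mem p := by
  intro i g hg
  unfold hull at hg
  cases hB : B i with
  | none => simp [hB] at hg
  | some e =>
    cases hC : C i with
    | none => simp [hB, hC] at hg
    | some f =>
      simp only [hB, hC, Option.some.injEq] at hg
      subst hg
      exact Entry.mem_hull_of_or (Or.inr (h i f hC))

/-- Each source refines the hull. [folklore] -/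
theorem refines_hull_left (B C : Box ι) : B.Refines (B.hull C) := fun _ => mem_hull_left

/-- Each source refines the hull. [folklore] -/
theorem refines_hull_right (B C : Box ι) : C.Refines (B.hull C) := fun _ => mem_hull_right

/-- Dropping a coordinate's entry (declaring it undetermined) only weakens the box. [folklore] -/
theorem refines_update_none [DecidableEq ι] (B : Box ι) (i : ι) :
    B.Refines (Function.update B i none) := by
  intro p hp j e hj
  by_cases hji : j = i
  · subst hji; simp at hj
  · rw [Function.update_of_ne hji] at hj
    exact hp j e hj

end Box

/-- **A word holds on a box**: the predicate `W` on parameter vectors holds at every vector of the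
box. Every statement the oracle attaches to a material through its box has this conditional form
(the box itself is a systematic, uncertified modelling claim). [folklore] -/
def HoldsOn {ι : Type*} (W : (ι → ℝ) → Prop) (B : Box ι) : Prop := ∀ p, B.Mem p → W p

/-- **Transfer along refinement** — the one inference rule of box words: a word certified on a
box holds on every box refining it (in particular on a downfolded box whose claimed enclosure sits
inside a certified cell). [folklore] -/
theorem HoldsOn.of_refines {ι : Type*} {W : (ι → ℝ) → Prop} {B C : Box ι} (hW : HoldsOn W C)
    (hBC : B.Refines C) : HoldsOn W B := fun p hp => hW p (hBC p hp)

/-- Words are monotone: a weaker predicate holds wherever a stronger one does. [folklore] -/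
theorem HoldsOn.mono {ι : Type*} {W W' : (ι → ℝ) → Prop} {B : Box ι} (hW : HoldsOn W B)
    (h : ∀ p, W p → W' p) : HoldsOn W' B := fun p hp => h p (hW p hp)

/-- A conjunction of words holds on a box iff both do. [folklore] -/
theorem holdsOn_and_iff {ι : Type*} {W W' : (ι → ℝ) → Prop} {B : Box ι} :
    HoldsOn (fun p => W p ∧ W' p) B ↔ HoldsOn W B ∧ HoldsOn W' B :=
  ⟨fun h => ⟨fun p hp => (h p hp).1, fun p hp => (h p hp).2⟩,
    fun h p hp => ⟨h.1 p hp, h.2 p hp⟩⟩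

end Summit.Ventures.CertifiedManyBodySolver.Downfold
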